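import Mathlib.AlgebraicGeometry.EllipticCurve.Affine.Point
import Mathlib.Algebra.CubicDiscriminant
import Mathlib.Algebra.Module.Torsion.Basic
import Mathlib.Data.Set.Card
import HarnessLib

/-!
# An elliptic curve has at most four `2`-torsion points; the structure of a `2`-torsion module of
# order `≤ 4` with a fixed point

Two elementary inputs of the quantitative `2`-descent for curves with a rational `2`-torsion point
(file `SelmerTwoTorsionBoundProofs`, discharging Bhargava–Shankar's Prop. 5.8 in the tree):

* `WeierstrassCurve.ncard_setOf_add_self_eq_zero_le` /
  `WeierstrassCurve.natCard_torsionBy_two_le` — for a Weierstrass curve `W` over a field `F` with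
  `2 ≠ 0`, **`#W(F)[2] ≤ 4`**: a point `P = (x, y)` with `2P = O` has `P = −P`, i.e.
  `2y + a₁x + a₃ = 0`, and then `x` is a root of the `2`-torsion cubic
  `4x³ + b₂x² + 2b₄x + b₆` (Mathlib's `WeierstrassCurve.twoTorsionPolynomial`), because
  `(2y + a₁x + a₃)² − (4x³ + b₂x² + 2b₄x + b₆)` is `4` times the Weierstrass equation; `y` is
  determined by `x`, so `P ↦ x(P)` injects `W(F)[2] ∖ {O}` into the at most three roots.
  Silverman, *The Arithmetic of Elliptic Curves*, 2nd ed., III.§2 (group law, (d): doubling and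
  `[2]P = O`) and Ex. 3.7; the exact count `#E[2] = 4` over `F̄` (Cor. III.6.4(b)) is the tree's
  named fact `WeierstrassCurve.card_torsionPoints_eq_sq` and is not needed here.
* `Literature.NumberTheory.EllipticCurves.sub_mem_pair_of_natCard_le_four` — **dévissage of a
  `2`-torsion module of order `≤ 4` along a fixed point**: if `M` is an abelian group with
  `#M ≤ 4` and `2M = 0`, `P ∈ M ∖ {0}`, and `σ : M → M` is an injective additive map fixing `P`
  (e.g. a Galois automorphism of `E[2]` fixing a rational `2`-torsion point), then
  `σ m − m ∈ {0, P}` for every `m` (so `Γ` acts trivially on `⟨P⟩` and on `M/⟨P⟩`). For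
  `m ∉ {0, P}` the four elements `0, P, m, m + P` exhaust `M`, and `σ m ∉ {0, P} = {σ 0, σ P}`.

## Mathlib

`WeierstrassCurve.Affine.Point.add_self_of_Y_ne` / `some_ne_zero` (doubling is `O` only if
`y = negY`), `WeierstrassCurve.twoTorsionPolynomial`, `Cubic.ne_zero_of_a_ne_zero`,
`Cubic.natDegree_of_a_ne_zero`, `Polynomial.card_roots'`, `Set.ncard_le_ncard_of_injOn`,
`Set.eq_of_subset_of_ncard_le`. Mathlib has the `2`-torsion polynomial and its discriminant but no
statement about the number of `2`-torsion points (searched `twoTorsion`, `torsionBy`, `card`).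

## Design

No definitions (the coordinate map `P ↦ x(P)` is an anonymous `match`). `open scoped Classical`
(the group law on `W.toAffine.Point` needs `DecidableEq F`, as in the tree's `GaloisAction`). The
point count is a deliberate dot-notation extension of Mathlib's `WeierstrassCurve` namespace; the
group lemma lives in the path namespace.
-/

open scoped Classical

open Polynomial

namespace WeierstrassCurve

variable {F : Type*} [Field F] (W : WeierstrassCurve F)

/-- **Doubling to `O` forces a root of the `2`-torsion cubic.** If `P = (x, y) ∈ W(F)` satisfies
`P + P = O` then `y = negY(x, y)` (i.e. `2y + a₁x + a₃ = 0`) and `x` is a root of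
`4x³ + b₂x² + 2b₄x + b₆`: indeed `(2y + a₁x + a₃)² − (4x³ + b₂x² + 2b₄x + b₆)` is `4` times the
Weierstrass equation. Silverman, *AEC*, III.§2 (group law algorithm 2.3(d)) and Ex. 3.7. [folklore] -/
theorem isRoot_twoTorsionPolynomial_of_add_self_eq_zero {x y : F} {h : W.toAffine.Nonsingular x y}
    (hP : Affine.Point.some x y h + Affine.Point.some x y h = 0) :
    y = W.toAffine.negY x y ∧ W.twoTorsionPolynomial.toPoly.IsRoot x := by
  have hy : y = W.toAffine.negY x y := by
    by_contra hy
    rw [Affine.Point.add_self_of_Y_ne hy] at hP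
    exact Affine.Point.some_ne_zero _ hP
  refine ⟨hy, ?_⟩
  have heq : y ^ 2 + W.a₁ * x * y + W.a₃ * y = x ^ 3 + W.a₂ * x ^ 2 + W.a₄ * x + W.a₆ :=
    (Affine.equation_iff _ _).mp h.left
  have hy' : 2 * y + W.a₁ * x + W.a₃ = 0 := by
    rw [Affine.negY] at hy
    linear_combination hy
  simp only [twoTorsionPolynomial, Cubic.toPoly, IsRoot.def, eval_add, eval_mul, eval_C, eval_pow,
    eval_X, b₂, b₄, b₆]
  linear_combination (2 * y + W.a₁ * x + W.a₃) * hy' - 4 * heq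

/-- **At most four points of order dividing `2`** on a Weierstrass curve over a field with `2 ≠ 0`:
`#{P ∈ W(F) : P + P = O} ≤ 4`. The map `P ↦ x(P)` (`O ↦ none`) is injective on these points
(`y = −(a₁x + a₃)/2` is determined by `x`) with values in `{none} ∪ {roots of the 2-torsion cubic}`,
a set with at most `1 + 3` elements. Silverman, *AEC*, III.§2 and Ex. 3.7 (the nonzero
`2`-torsion points are the `(x, y)` with `x` a root of `4x³ + b₂x² + 2b₄x + b₆`). [folklore] -/
theorem ncard_setOf_add_self_eq_zero_le (h2 : (2 : F) ≠ 0) :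
    {P : W.toAffine.Point | P + P = 0}.ncard ≤ 4 := by
  classical
  set g : F[X] := W.twoTorsionPolynomial.toPoly with hg
  have h4 : (4 : F) ≠ 0 := by
    rw [show (4 : F) = 2 * 2 by norm_num]
    exact mul_ne_zero h2 h2
  have hg0 : g ≠ 0 := Cubic.ne_zero_of_a_ne_zero (P := W.twoTorsionPolynomial) h4
  have hdeg : g.natDegree = 3 := Cubic.natDegree_of_a_ne_zero (P := W.twoTorsionPolynomial) h4
  -- the coordinate map
  let xo : W.toAffine.Point → Option F := fun P ↦ match P with
    | .zero => none
    | .some x _ _ => some x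
  -- its values on the `2`-torsion points
  set T : Set (Option F) := insert none ((fun x : F ↦ (some x : Option F)) '' {x | g.IsRoot x})
    with hT
  have hroots : {x | g.IsRoot x} = (g.roots.toFinset : Set F) := by
    ext x
    simp [Polynomial.mem_roots hg0]
  have hTfin : T.Finite := by
    rw [hT, hroots]
    exact ((g.roots.toFinset.finite_toSet).image _).insert none
  have hTcard : T.ncard ≤ 4 := by
    calc T.ncard ≤ ((fun x : F ↦ (some x : Option F)) '' {x | g.IsRoot x}).ncard + 1 :=
          Set.ncard_insert_le _ _
      _ = {x | g.IsRoot x}.ncard + 1 := by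
          rw [Set.ncard_image_of_injective _ (Option.some_injective F)]
      _ ≤ 3 + 1 := by
          rw [hroots, Set.ncard_coe_finset]
          have h1 := g.roots.toFinset_card_le
          have h2 := g.card_roots'
          omega
      _ = 4 := rfl
  have hmaps : ∀ P ∈ {P : W.toAffine.Point | P + P = 0}, xo P ∈ T := by
    rintro (_ | ⟨x, y, h⟩) hP
    · exact Set.mem_insert _ _
    · exact Set.mem_insert_of_mem _
        ⟨x, (W.isRoot_twoTorsionPolynomial_of_add_self_eq_zero hP).2, rfl⟩
  have hinj : Set.InjOn xo {P : W.toAffine.Point | P + P = 0} := by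
    rintro (_ | ⟨x₁, y₁, h₁⟩) hP (_ | ⟨x₂, y₂, h₂⟩) hQ hPQ
    · rfl
    · exact absurd hPQ (by simp [xo])
    · exact absurd hPQ (by simp [xo])
    · have hx : x₁ = x₂ := by simpa [xo] using hPQ
      subst hx
      have hy₁ := (W.isRoot_twoTorsionPolynomial_of_add_self_eq_zero hP).1
      have hy₂ := (W.isRoot_twoTorsionPolynomial_of_add_self_eq_zero hQ).1
      rw [Affine.negY] at hy₁ hy₂
      have hy : y₁ = y₂ := by
        have : (2 : F) * (y₁ - y₂) = 0 := by linear_combination hy₁ - hy₂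
        exact sub_eq_zero.mp ((mul_eq_zero.mp this).resolve_left h2)
      subst hy
      rfl
  exact (Set.ncard_le_ncard_of_injOn xo hmaps hinj hTfin).trans hTcard

/-- **`#W(F)[2] ≤ 4`** (`2 ≠ 0` in `F`): the `2`-torsion subgroup
`W(F)[2] = AddSubgroup.torsionBy W(F) 2` has at most four elements.
Silverman, *AEC*, III.§2, Ex. 3.7 (and Cor. III.6.4(b) for equality over `F̄`). [folklore] -/
theorem natCard_torsionBy_two_le (h2 : (2 : F) ≠ 0) :
    Nat.card (AddSubgroup.torsionBy W.toAffine.Point (2 : ℤ)) ≤ 4 := by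
  rw [← SetLike.coe_sort_coe, Nat.card_coe_set_eq]
  have hset : ((AddSubgroup.torsionBy W.toAffine.Point (2 : ℤ) : AddSubgroup W.toAffine.Point) :
      Set W.toAffine.Point) = {P | P + P = 0} := by
    ext P
    simp only [SetLike.mem_coe, Set.mem_setOf_eq]
    rw [Submodule.mem_toAddSubgroup, Submodule.mem_torsionBy_iff, two_zsmul]
  rw [hset]
  exact W.ncard_setOf_add_self_eq_zero_le h2

end WeierstrassCurve

namespace Literature.NumberTheory.EllipticCurves

/-- **Dévissage of a `2`-torsion module of order at most `4` along a fixed point.** Let `M` be an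
abelian group with `#M ≤ 4` (`M` finite) and `m + m = 0` for all `m`, let `P ∈ M ∖ {0}`, and let
`σ : M →+ M` be injective with `σ P = P`. Then `σ m − m ∈ {0, P}` for every `m ∈ M`. (For
`m ∈ {0, P}` this is `σ m = m`; otherwise `0, P, m, m + P` are four distinct elements, hence all of
`M`, and `σ m ∉ {σ 0, σ P} = {0, P}`, so `σ m ∈ {m, m + P}`.) Applied to `M = E[2]` and a
rational `2`-torsion point `P`, this says that Galois acts trivially on `⟨P⟩` and on `E[2]/⟨P⟩`,
the dévissage behind descent via `2`-isogeny (Silverman, *AEC*, X.§4, Ex. 4.8–Prop. 4.9). [folklore] -/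
theorem sub_mem_pair_of_natCard_le_four {M : Type*} [AddCommGroup M] [Finite M]
    (h4 : Nat.card M ≤ 4) (h2 : ∀ m : M, m + m = 0) {P : M} (hP : P ≠ 0) (σ : M →+ M)
    (hσ : Function.Injective σ) (hσP : σ P = P) (m : M) : σ m - m = 0 ∨ σ m - m = P := by
  classical
  by_cases hm0 : m = 0
  · left; rw [hm0, map_zero, sub_zero]
  by_cases hmP : m = P
  · left; rw [hmP, hσP, sub_self]
  -- `0, P, m, m + P` are distinct, hence exhaust `M`
  have hnegP : -P = P := by rw [neg_eq_iff_add_eq_zero, h2]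
  have hmP0 : m + P ≠ 0 := fun h ↦ hmP (by rw [← hnegP, eq_neg_iff_add_eq_zero, h])
  have hmPP : m + P ≠ P := fun h ↦ hm0 (by simpa using h)
  have hmPm : m + P ≠ m := fun h ↦ hP (by simpa using h)
  have huniv : ({0, P, m, m + P} : Set M) = Set.univ := by
    apply Set.eq_of_subset_of_ncard_le (Set.subset_univ _)
    rw [Set.ncard_univ]
    refine h4.trans (le_of_eq ?_)
    have hA : (0 : M) ∉ ({P, m, m + P} : Set M) := by
      simp only [Set.mem_insert_iff, Set.mem_singleton_iff, not_or]
      exact ⟨hP.symm, fun h ↦ hm0 h.symm, fun h ↦ hmP0 h.symm⟩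
    have hB : P ∉ ({m, m + P} : Set M) := by
      simp only [Set.mem_insert_iff, Set.mem_singleton_iff, not_or]
      exact ⟨fun h ↦ hmP h.symm, fun h ↦ hmPP h.symm⟩
    rw [Set.ncard_insert_of_notMem hA, Set.ncard_insert_of_notMem hB, Set.ncard_pair hmPm.symm]
  -- `σ m ∉ {0, P}`, so `σ m ∈ {m, m + P}`
  have hσm0 : σ m ≠ 0 := fun h ↦ hm0 (hσ (by rw [h, map_zero]))
  have hσmP : σ m ≠ P := fun h ↦ hmP (hσ (by rw [h, hσP]))
  have hmem : σ m ∈ ({0, P, m, m + P} : Set M) := by rw [huniv]; exact Set.mem_univ _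
  simp only [Set.mem_insert_iff, Set.mem_singleton_iff] at hmem
  rcases hmem with h | h | h | h
  · exact absurd h hσm0
  · exact absurd h hσmP
  · left; rw [h, sub_self]
  · right; rw [h, add_sub_cancel_left]

end Literature.NumberTheory.EllipticCurves
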